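import Summits.CriticalPhenomena.Ising3DConformalLimit.Theorems.GapForcesFarMerging.Negative.SoftFamilies

/-!
# `GapForcesFarMerging` is not soft, VI: family A is not reflection positive

Part 6 — `familyA_not_rpCauchySchwarz`: the explicit family A of Parts 1–4 VIOLATES the
reflection-positivity Cauchy–Schwarz minor `⟨ε_b;σ_{θp}σ_{θq}⟩² ≤ ⟨ε_b;ε_{θb}⟩·⟨σ_pσ_q;σ_{θp}σ_{θq}⟩`
across the site mirror `θ : y₁ ↦ 10 - y₁` (`b = {0,e₂}`, `p = (4,20,0)`, `q = (4,0,0)`): its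
diagonal entry vanishes (the energy truncation of family A is `|g(x)² - g(x+e₂)g(x-e₂)| = 0` on the
`e₁` axis) while the off-diagonal entry is `1/140 - 1/147`. For the critical Ising state the minor
is nonnegative (site-plane reflection positivity, Fröhlich–Israel–Lieb–Simon 1978, Thm 3.1). Hence
reflection positivity is GENUINELY outside the soft package of Part 1: the no-go theorems of Part 4
do not touch the RP lever of the crux ideas `rp-unpinch-single-passage` / `rp-gram-halving` (only
their residual "one-ended gap ⇒ far merging", `oneEndedGapForcesFarMerging_false_without_model`),
and an RP-positive family with the GAP shape and no far merging is the next, sharper no-go to build.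

Split of the standing adversary's work file
`Summits/CriticalPhenomena/Ising3DConformalLimit/Cruxes/GapForcesFarMerging/Disproof.lean` (§5),
crux `stmt-CriticalPhenomena-4468`, route `EnergyNotSigmaSquared`.

## References

* J. Fröhlich, R. Israel, E. H. Lieb, B. Simon, Comm. Math. Phys. 62 (1978) 1–34, Thm 3.1
  [FrohlichIsraelLiebSimon1978].
-/

noncomputable section

namespace Summit.CriticalPhenomena.Ising3DConformalLimit.Theorems.GapForcesFarMerging.Negative

open Literature.Probability.LatticeModels
open Summit.CriticalPhenomena.Ising3DConformalLimit.Theses.EnergyNotSigmaSquared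

/-- Sup norm of an explicit vector of `ℤ³`. [folklore] -/
theorem norm_vec3 (a b c : ℤ) :
    ‖(![a, b, c] : Site 3)‖ = max |(a : ℝ)| (max |(b : ℝ)| |(c : ℝ)|) := by
  apply le_antisymm
  · refine (pi_norm_le_iff_of_nonneg (by positivity)).2 fun i => ?_
    fin_cases i
    · simp [Int.norm_eq_abs]
    · simp [Int.norm_eq_abs]
    · simp [Int.norm_eq_abs]
  · have h0 := norm_le_pi_norm (![a, b, c] : Site 3) 0
    have h1 := norm_le_pi_norm (![a, b, c] : Site 3) 1
    have h2 := norm_le_pi_norm (![a, b, c] : Site 3) 2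
    simp only [Matrix.cons_val_zero, Matrix.cons_val_one, Matrix.cons_val, Int.norm_eq_abs] at h0 h1 h2
    exact max_le h0 (max_le h1 h2)

/-- `g` of an explicit vector. [folklore] -/
theorem g_vec3 (a b c : ℤ) : g ![a, b, c] = (1 + max |(a : ℝ)| (max |(b : ℝ)| |(c : ℝ)|))⁻¹ := by
  rw [g_eq, norm_vec3]

/-- **Family A is not reflection positive.** The RP–Cauchy–Schwarz inequality across the site
mirror `θ : y₁ ↦ 10 - y₁` FAILS for family A with `F = ε_b - ⟨ε_b⟩`, `b = {0, e₂}` (so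
`θb = {x, x + e₂}`, `x = 10e₁`) and `G = σ_pσ_q - ⟨σ_pσ_q⟩`, `p = (4,20,0)`, `q = (4,0,0)` (so
`θp = (6,20,0)`, `θq = (6,0,0)`): the diagonal entry `⟨ε_b ; ε_{θb}⟩_A` VANISHES (family A's energy
truncation `|g(x)² - g(x+e₂)g(x-e₂)|` is `0` on the `e₁` axis) while the off-diagonal entry
`⟨ε_b ; σ_{θp}σ_{θq}⟩_A = 1/140 - 1/147 ≠ 0`. For the critical Ising state the inequality
`⟨ε_b;σ_{θp}σ_{θq}⟩² ≤ ⟨ε_b;ε_{θb}⟩·⟨σ_pσ_q;σ_{θp}σ_{θq}⟩` holds (site-plane reflection positivity,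
Fröhlich–Israel–Lieb–Simon 1978). So reflection positivity is GENUINELY outside the soft package —
the precise sense of §5. [cite: FrohlichIsraelLiebSimon1978, Thm 3.1] -/
theorem familyA_not_rpCauchySchwarz :
    ¬ ((FA ![0, e₂, ![6, 20, 0], ![6, 0, 0]] - S₀ 0 e₂ * S₀ ![6, 20, 0] ![6, 0, 0]) ^ 2 ≤
        (FA ![0, e₂, ![10, 0, 0], ![10, 0, 0] + e₂] - S₀ 0 e₂ * S₀ ![10, 0, 0] (![10, 0, 0] + e₂)) *
          (FA ![![4, 20, 0], ![4, 0, 0], ![6, 20, 0], ![6, 0, 0]] -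
            S₀ ![4, 20, 0] ![4, 0, 0] * S₀ ![6, 20, 0] ![6, 0, 0])) := by
  -- the diagonal (GAP) entry vanishes
  have hx1 : (![10, 0, 0] : Site 3) + e₂ = ![10, 1, 0] := by
    ext i; fin_cases i <;> simp
  have hx2 : (![10, 0, 0] : Site 3) - e₂ = ![10, -1, 0] := by
    ext i; fin_cases i <;> simp
  have hθ1 : θA ![0, e₂, ![10, 0, 0], ![10, 0, 0] + e₂] = 1 := by
    unfold θA; rw [max_eq_left (sep_adjacent_le_one _)]; simp
  have hdiag : FA ![0, e₂, ![10, 0, 0], ![10, 0, 0] + e₂] -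
      S₀ 0 e₂ * S₀ ![10, 0, 0] (![10, 0, 0] + e₂) = 0 := by
    rw [FA, adjacent_trunc_eq, pmin_adjacent_eq, hθ1, hx1, hx2, g_e₂, g_vec3, g_vec3, g_vec3]
    norm_num
  -- the off-diagonal entry is 1/140 - 1/147
  set y : Site 3 := ![6, 20, 0] with hy
  set z : Site 3 := ![6, 0, 0] with hz
  set w : Fin 4 → Site 3 := ![0, e₂, y, z] with hw
  have hθ : θA w = 1 := by
    unfold θA
    have h := sep_le_norm w (i := 0) (j := 1) (by decide)
    have h1 : sep w ≤ 1 := by simpa [hw, norm_e₂] using h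
    rw [max_eq_left h1]; simp
  have hzy : z - y = ![0, -20, 0] := by ext i; fin_cases i <;> simp [hy, hz]
  have hze : z - e₂ = ![6, -1, 0] := by ext i; fin_cases i <;> simp [hz]
  have hye : y - e₂ = ![6, 19, 0] := by ext i; fin_cases i <;> simp [hy]
  have hP1 : P₁ S₀ w = g e₂ * g (z - y) := by simp [P₁, hw, S₀]
  have hP2 : P₂ S₀ w = g y * g (z - e₂) := by simp [P₂, hw, S₀]
  have hP3 : P₃ S₀ w = g z * g (y - e₂) := by simp [P₃, hw, S₀]
  have hS1 : S₀ 0 e₂ * S₀ y z = g e₂ * g (z - y) := by simp [S₀]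
  have hoff : FA w - S₀ 0 e₂ * S₀ y z = 1 / 140 - 1 / 147 := by
    have hF : FA w - S₀ 0 e₂ * S₀ y z =
        P₂ S₀ w + P₃ S₀ w - 2 * min (min (P₁ S₀ w) (P₂ S₀ w)) (P₃ S₀ w) := by
      simp only [FA, Fθ, wick, pmin, hθ, mul_one, hS1, hP1]; ring
    rw [hF, hP1, hP2, hP3, hzy, hze, hye, g_e₂, hy, hz, g_vec3, g_vec3, g_vec3, g_vec3, g_vec3]
    norm_num
  rw [hoff, hdiag, zero_mul]
  norm_num

end Summit.CriticalPhenomena.Ising3DConformalLimit.Theorems.GapForcesFarMerging.Negative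

end
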